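import Literature.Probability.RandomPlanarGeometry.RadialHorizonCausality
import Literature.Probability.RandomPlanarGeometry.DrivingIncrementAC
import HarnessLib

/-!
# The driving increments of the stationary angle law are locally generated inside the disc, a.s.

Topic `Probability/RandomPlanarGeometry`; one definition with body (`angleIncrPath`) and proved
theorems (no named fact). Sequel of `DrivingIncrementAC` (absolute continuity of the driving
increments of a stationary SLE_κ(ρ) angle law with respect to Brownian motion, on `T`-stopped
paths) and `RadialHorizonCausality` (for every Brownian motion and `κ ≤ 4`, the `T`-stopped driving
path is a.s. locally generated inside the disc up to its own path horizon). Combining them at every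
base time `b` (stationarity) gives the probabilistic input of Miller–Sheffield (2013), proof of
Prop. 2.5, in the regime `κ ≤ 4`, `κ ≤ 2(ρ + 2)`:

* `angleIncrPath x b u = x(b + u) - x(b) - ∫_b^{b+u} cot(x_s/2) ds` — the (unnormalised) driving
  increment `λ_{b+u} - λ_b` of the whole-plane chain as a functional of the angle path;
* `IsStationaryAngleLaw.ae_locallyGeneratedSimple_angleIncrPath` — under a stationary angle law,
  for every base time `b`, almost surely the radial Loewner chain of the increment path is locally
  generated by a curve staying inside the disc up to the path horizon.

## References

* J. Miller, S. Sheffield, *Imaginary geometry IV*, PTRF 169 (2017), arXiv:1302.4738, Prop. 2.5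
  (proof) and §2.1. [MillerSheffield2013]
* G. F. Lawler, *Conformally Invariant Processes in the Plane*, AMS (2005), §6.5. [Lawler2005]
-/

noncomputable section

open MeasureTheory ProbabilityTheory Filter Topology Set Metric
open scoped NNReal ENNReal Real

namespace Literature.Probability.RandomPlanarGeometry

open scoped PathBorel
open RadialSLE RadialLoewner

/-- The **driving increment of the whole-plane chain after the base time `b`** as a functional of
the angle path: `λ_{b+u} - λ_b = X_{b+u} - X_b - ∫_b^{b+u} cot(X_s/2) ds` (`λ = q + X`,
`dq = -cot(X/2) dt`). [cite: MillerSheffield2013, §2.1.2] -/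
def angleIncrPath (x : C(ℝ, ℝ)) (b : ℝ) : ℝ≥0 → ℝ :=
  fun u ↦ x (b + u) - x b - ∫ s in b..(b + u), Real.cot (x s / 2)

/-- Unfolding of `angleIncrPath`. [folklore] -/
theorem angleIncrPath_apply (x : C(ℝ, ℝ)) (b : ℝ) (u : ℝ≥0) :
    angleIncrPath x b u = x (b + u) - x b - ∫ s in b..(b + u), Real.cot (x s / 2) := rfl

/-- `cot(x_s/2)` is continuous along an angle path living in `(0, 2π)`. [folklore] -/
theorem continuous_cot_half {x : C(ℝ, ℝ)} (hx : ∀ t, x t ∈ Ioo 0 (2 * π)) :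
    Continuous fun s ↦ Real.cot (x s / 2) := by
  have h1 : ∀ s, Real.sin (x s / 2) ≠ 0 := fun s ↦ by
    have := hx s
    exact (Real.sin_pos_of_pos_of_lt_pi (by linarith [this.1]) (by linarith [this.2])).ne'
  simp only [Real.cot_eq_cos_div_sin]
  exact (Real.continuous_cos.comp (x.continuous.div_const _)).div
    (Real.continuous_sin.comp (x.continuous.div_const _)) h1

/-- The increment path of an angle path living in `(0, 2π)` is continuous. [folklore] -/
theorem continuous_angleIncrPath {x : C(ℝ, ℝ)} (hx : ∀ t, x t ∈ Ioo 0 (2 * π)) (b : ℝ) :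
    Continuous (angleIncrPath x b) := by
  have hprim : Continuous fun v : ℝ ↦ ∫ s in b..v, Real.cot (x s / 2) :=
    intervalIntegral.continuous_primitive (fun _ _ ↦ (continuous_cot_half hx).intervalIntegrable _ _) b
  have hbu : Continuous fun u : ℝ≥0 ↦ b + (u : ℝ) := continuous_const.add NNReal.continuous_coe
  exact ((x.continuous.comp hbu).sub continuous_const).sub (hprim.comp hbu)

variable {κ : ℝ≥0} {ρ : ℝ} {P : Measure C(ℝ, ℝ)}

/-- **Under a stationary SLE_κ(ρ) angle law (`κ ≤ 4`), from every base time the increment path is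
a.s. locally generated inside the disc up to its path horizon.** Proof: the set `Bad` of paths `p`
for which `√κ p` is not (continuous and) locally generated inside the disc up to the path horizon
of `√κ p` is null for the `T`-stopped path of every Brownian motion
(`RadialSLE.ae_locallyGeneratedSimple_stopPath'`, after recentring `B ↦ B - B₀`); by
`IsStationaryAngleLaw.drivingIncrement_shift_null_of_brownian_null` it is null for the stopped
normalised increment `ξ^b`; and the unstopped increment has the same horizon and the same local
generation (`pathHorizon_eq_of_eqOn`, `LocallyGeneratedSimple.of_eqOn`).
[cite: MillerSheffield2013, Prop. 2.5 (proof)] -/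
theorem IsStationaryAngleLaw.ae_locallyGeneratedSimple_angleIncrPath (hP : IsStationaryAngleLaw κ ρ P)
    (hκ : 0 < κ) (hκ4 : κ ≤ 4) (b : ℝ) {n : ℕ} {ε : ℝ} (hε : 0 < ε) (hε2 : ε < π / 2)
    (hnε : 2 * level n < ε / 2) (T : ℝ≥0) :
    ∀ᵐ x ∂P, ∃ hc : Continuous (angleIncrPath x b),
      LocallyGeneratedSimple (angleIncrPath x b) (pathHorizon n ε T ⟨angleIncrPath x b, hc⟩) := by
  have hsq0 : 0 < Real.sqrt κ := Real.sqrt_pos.2 (by exact_mod_cast hκ)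
  have hsq : Real.sqrt κ ≠ 0 := hsq0.ne'
  -- the good property of a path, and its invariance under change of representative
  have good_congr : ∀ {f g : ℝ≥0 → ℝ}, f = g → (∃ hc : Continuous f,
      LocallyGeneratedSimple f (pathHorizon n ε T ⟨f, hc⟩)) →
      ∃ hc : Continuous g, LocallyGeneratedSimple g (pathHorizon n ε T ⟨g, hc⟩) := by
    rintro f g rfl h; exact h
  -- the bad set of (normalised) paths
  set Bad : Set (ℝ≥0 → ℝ) := {p | ¬ ∃ hc : Continuous (fun u ↦ Real.sqrt κ * p u),
    LocallyGeneratedSimple (fun u ↦ Real.sqrt κ * p u)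
      (pathHorizon n ε T ⟨fun u ↦ Real.sqrt κ * p u, hc⟩)} with hBad_def
  -- it is null for the stopped path of every Brownian motion
  have hBad : ∀ (Ω' : Type) [MeasurableSpace Ω'] (P' : Measure Ω') [IsProbabilityMeasure P']
      (B : ℝ≥0 → Ω' → ℝ), IsBrownianReal B P' → (∀ t, Measurable (B t)) →
      (∀ ω, Continuous (B · ω)) → P' {ω | (fun t ↦ B (min t T) ω) ∈ Bad} = 0 := by
    intro Ω' _ P' _ B hB hBm hBc
    set B' : ℝ≥0 → Ω' → ℝ := fun t ω ↦ B (0 + t) ω - B 0 ω with hB'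
    have hB'BM : IsBrownianReal B' P' := hB.shift 0
    have hB'm : ∀ t, Measurable (B' t) := fun t ↦ (hBm _).sub (hBm 0)
    have hB'c : ∀ ω, Continuous (B' · ω) := fun ω ↦
      ((hBc ω).comp (continuous_const.add continuous_id)).sub continuous_const
    have hB'0 : ∀ ω, B' 0 ω = 0 := fun ω ↦ by simp [hB']
    have h1 := ae_locallyGeneratedSimple_stopPath' hB'BM hB'm hB'c hB'0 hκ hκ4 hε hε2 hnε T
    have h2 := hB.eval_zero_ae_eq_zero
    have h12 := ae_iff.1 (h1.and h2)
    refine measure_mono_null (fun ω hω ↦ ?_) h12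
    simp only [mem_setOf_eq, not_and_or]
    by_contra hgood
    push Not at hgood
    obtain ⟨hg1, hg2⟩ := hgood
    have heq : stopPath T (bmDriving κ B' ω) = fun u ↦ Real.sqrt κ * B (min u T) ω := by
      funext u
      simp only [stopPath_apply, bmDriving, hB', zero_add]
      rw [show B 0 ω = 0 from hg2, sub_zero]
    exact hω (good_congr heq ⟨_, hg1⟩)
  -- absolute continuity of the stopped increment, from the base time `b`
  have hnull := hP.drivingIncrement_shift_null_of_brownian_null hκ b T hBad
  have hIoo : ∀ᵐ x ∂P, ∀ t : ℝ, x t ∈ Ioo 0 (2 * π) := hP.2.1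
  have hae : ∀ᵐ x ∂P, (fun t : ℝ≥0 ↦ (x (b + min (t : ℝ) T) - x b -
      ∫ u in b..(b + min (t : ℝ) T), Real.cot (x u / 2)) / Real.sqrt κ) ∉ Bad := by
    rw [ae_iff]; simpa only [not_not] using hnull
  filter_upwards [hae, hIoo] with x hx hxI
  simp only [hBad_def, mem_setOf_eq, not_not] at hx
  -- `√κ · ξ^{b,T} = stopPath T (angleIncrPath x b)`
  have heq : (fun u : ℝ≥0 ↦ Real.sqrt κ * ((x (b + min (u : ℝ) T) - x b -
      ∫ s in b..(b + min (u : ℝ) T), Real.cot (x s / 2)) / Real.sqrt κ)) =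
      stopPath T (angleIncrPath x b) := by
    funext u
    rw [mul_div_cancel₀ _ hsq, stopPath_apply, angleIncrPath_apply, NNReal.coe_min]
  obtain ⟨hcT, hLG⟩ := good_congr heq hx
  have hc : Continuous (angleIncrPath x b) := continuous_angleIncrPath hxI b
  refine ⟨hc, ?_⟩
  have hhor : pathHorizon n ε T ⟨stopPath T (angleIncrPath x b), hcT⟩ =
      pathHorizon n ε T ⟨angleIncrPath x b, hc⟩ :=
    pathHorizon_eq_of_eqOn n ε fun t ht ↦ (stopPath_eq_of_le (angleIncrPath x b) ht : _)
  rw [hhor] at hLG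
  exact hLG.of_eqOn hcT hc (fun s hs ↦ stopPath_eq_of_le _ hs) (by exact_mod_cast pathHorizon_le n ε T _)

end Literature.Probability.RandomPlanarGeometry
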